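import Literature.Analysis.FluidPDE.KNSSTypeIIContinuation
import Literature.Analysis.FluidPDE.AxisymmetricTypeIAxis
import Literature.Analysis.FluidPDE.AxisymmetricTypeIOffAxis
import Literature.Analysis.FluidPDE.AxisymmetricTypeIInfinity
import HarnessLib

/-!
# `knss_no_axisymmetric_typeI` from the printed literature: final assembly

Analysis/FluidPDE proofs-layer file (theorems only), top of the decomposition of the named fact
`Literature.Analysis.FluidPDE.knss_no_axisymmetric_typeI` (`Axisymmetric.lean`; Koch–Nadirashvili–
Seregin–Šverák 2009, §6: axisymmetric Leray–Hopf solutions with a Type I bound do not blow up).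
It assembles the layers landed in

* `KNSSTypeII.lean` — `knss_no_axisymmetric_typeI_of_parts : KNSS2009_regularity_bound_C_over_r →
  hasSmoothExtensionPast_of_bounded → axisymmetric_typeI_bounded → knss_no_axisymmetric_typeI`
  (the space form `|u| ≤ C/|x'|`, KNSS Thm. 6.1, is a named fact; the time form is reduced to
  boundedness of the solution plus continuation of bounded Leray–Hopf solutions);
* `KNSSTypeIIContinuation.lean` — `hasSmoothExtensionPast_of_bounded_of_local_H1_theory :
  leray_local_strong_H1 → tao2011_H1_local_almost_regular → hasSmoothExtensionPast_of_bounded`;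
* `AxisymmetricTypeIBounded.lean` — `axisymmetric_typeI_bounded_of_local`: boundedness from the
  three local inputs (axis points, off-axis points, spatial infinity);
* `AxisymmetricTypeIAxis.lean` — `axisymmetric_typeI_boundedNearTop_axis_of_barrier :
  AxisymmetricTypeIExclusion → axisymmetric_typeI_boundedNearTop_axis` (Seregin–Šverák 2009,
  Thm. 3.1 = Thm. 1.1, catalogued barrier);
* `AxisymmetricTypeIOffAxis.lean` — `axisymmetric_typeI_boundedNearTop_offAxis_of_seregin :
  seregin2014_thm14 → axisymmetric_typeI_boundedNearTop_offAxis` (Seregin 2014, Ch. 6, Thm. 1.4);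
* `AxisymmetricTypeIInfinity.lean` — `typeI_boundedNearTop_infinity_of_LR :
  lemarieRieusset_epsilon_regularity → typeI_boundedNearTop_infinity` (Lemarié-Rieusset 2016,
  Thm. 14.4),

into

  `knss_no_axisymmetric_typeI_of_literature :
     KNSS2009_regularity_bound_C_over_r → leray_local_strong_H1 →
     tao2011_H1_local_almost_regular → AxisymmetricTypeIExclusion → seregin2014_thm14 →
     lemarieRieusset_epsilon_regularity → knss_no_axisymmetric_typeI`.

Thus the trust base of `knss_no_axisymmetric_typeI` is exactly these six PRINTED results, each
vendored as a named fact with its locator: KNSS 2009 Thm. 6.1 [KochNadirashviliSereginSverak2009];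
Robinson–Rodrigo–Sadowski 2016 Thm. 6.15 (local strong `H¹` solutions) [RobinsonRodrigoSadowski2016];
Tao 2011 Thm. 5.4/Prop. 5.6 (`H¹` local almost-regularity, arXiv:1108.1165) [Tao2011]; Seregin–Šverák 2009 Thm. 3.1
[SereginSverak2009]; Seregin 2014 Ch. 6 Thm. 1.4 [Seregin2014]; Lemarié-Rieusset 2016 Thm. 14.4
[LemarieRieusset2016]. Everything else (the reduction of KNSS Thm. 6.2's conclusion for finite-energy
solutions, pressure gauge and bounds, rescalings, packing, tails, continuation) is proved in the tree.

## References

* G. Koch, N. Nadirashvili, G. Seregin, V. Šverák, *Liouville theorems for the Navier–Stokes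
  equations and applications*, Acta Math. 203 (2009), §6, Thms. 6.1–6.2 (arXiv:0709.3599,
  pp. 11–13). [KochNadirashviliSereginSverak2009]
* G. Seregin, V. Šverák, Comm. PDE 34 (2009), Thm. 1.1 / Thm. 3.1. [SereginSverak2009]
* G. Seregin, *Lecture Notes on Regularity Theory for the Navier–Stokes Equations*, 2014, Ch. 6,
  Thm. 1.4. [Seregin2014]
* P. G. Lemarié-Rieusset, *The Navier–Stokes Problem in the 21st Century*, 2016, Thm. 14.4.
  [LemarieRieusset2016]
* J. C. Robinson, J. L. Rodrigo, W. Sadowski, *The Three-Dimensional Navier–Stokes Equations*,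
  2016, Thms. 6.15, 8.17. [RobinsonRodrigoSadowski2016]
* T. Tao, *Localisation and compactness properties of the Navier–Stokes global regularity
  problem*, arXiv:1108.1165 (Anal. PDE 6 (2013)), Thm. 5.4, Prop. 5.6. [Tao2011]
-/

noncomputable section

namespace Literature.Analysis.FluidPDE

open Literature.Barriers.NavierStokesRegularity

/-- **Boundedness of axisymmetric Type I solutions from the printed local regularity theory**:
the three local inputs of `axisymmetric_typeI_bounded_of_local` supplied by the Seregin–Šverák
barrier (axis), Seregin's multi-scale ε-regularity criterion (off the axis) and the one-scale
Caffarelli–Kohn–Nirenberg criterion (at infinity).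
[cite: SereginSverak2009, Thm 3.1 (= Thm 1.1)] -/
theorem axisymmetric_typeI_bounded_of_literature (hSS : AxisymmetricTypeIExclusion)
    (hSer : seregin2014_thm14) (hLR : lemarieRieusset_epsilon_regularity) :
    axisymmetric_typeI_bounded :=
  axisymmetric_typeI_bounded_of_local (axisymmetric_typeI_boundedNearTop_axis_of_barrier hSS)
    (axisymmetric_typeI_boundedNearTop_offAxis_of_seregin hSer)
    (typeI_boundedNearTop_infinity_of_LR hLR)

/-- **KNSS 2009, §6 (no axisymmetric Type I blow-up) from the printed literature.** The named fact
`knss_no_axisymmetric_typeI` follows from the six vendored printed results: KNSS Thm. 6.1 (space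
form), the local `H¹` theory (RRS Thm. 6.15, Tao 2011 Thm. 5.4) for the continuation of bounded
Leray–Hopf solutions, and — for the boundedness of finite-energy axisymmetric Type I solutions up to
the blow-up time — Seregin–Šverák 2009 Thm. 3.1, Seregin 2014 Ch. 6 Thm. 1.4 and Lemarié-Rieusset 2016
Thm. 14.4. [cite: KochNadirashviliSereginSverak2009, Thms 6.1–6.2 (§6, arXiv pp. 11–13)] -/
theorem knss_no_axisymmetric_typeI_of_literature (h61 : KNSS2009_regularity_bound_C_over_r)
    (hL : leray_local_strong_H1) (hTao : tao2011_H1_local_almost_regular)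
    (hSS : AxisymmetricTypeIExclusion) (hSer : seregin2014_thm14)
    (hLR : lemarieRieusset_epsilon_regularity) : knss_no_axisymmetric_typeI :=
  knss_no_axisymmetric_typeI_of_parts h61 (hasSmoothExtensionPast_of_bounded_of_local_H1_theory hL hTao)
    (axisymmetric_typeI_bounded_of_literature hSS hSer hLR)

end Literature.Analysis.FluidPDE

end
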